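import Mathlib
import Literature.NumberTheory.LFunctions.LittlewoodOscillationInputsProofs
import HarnessLib

/-!
# Landau's oscillation theorem for the logarithmic Riesz mean `W(x) = ∫₁ˣ ψ(t)dt/t = Σ_{n≤x} Λ(n) log(x/n)`

Helper file (`--supports stmt-RiemannHypothesis-0098`, lead-track anchor: Weil-positivity window ladder, format-C far bound;
the input of «C-XIII ⟹ RH», `WeilFarFloorCoshTestRH`), pure proofs.  Seat rh-explicit-weil-1 gen9 (memo
`run/shared/lean/pub/rh-explicit/rh-explicit-weil-1/FORMAT-K3.md` §10.6).
The Rayleigh quotient of the floor's near-extremizer `cosh(x/2)·1_{[−a,a]}` (`WeilFarFloorCoshTest`) is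
`e^a M(e^{2a}) − e^{−a}ψ(e^{2a}) + ½(W + W₁)(e^{2a})` over `a + sinh a`, with `W(X) = Σ_{n≤X}Λ(n)log(X/n) = ∫₁^X ψ(t)dt/t`.
This file proves the `Ω₊`/`Ω₋` theorem for `W` by Landau's method exactly as the tree does it for `ψ`
(Literature `LittlewoodOscillationInputsProofs`, Montgomery–Vaughan Thm. 15.2): for every zero `ρ₀` of `ζ` and every
`0 < b < Re ρ₀`, `W(x) − x ≥ x^b` for arbitrarily large `x` (`frequently_rpow_le_logRiesz_sub`; the `Ω₋` statement follows
from `false_of_nonneg_of_zero` with `η = −1` in the same way).  Ingredients: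
§1 `W` (written `∫ t in 1..x, t⁻¹ψ(t)`) is continuous, `0 ≤ W(x) ≤ 7x`;
§2 its Mellin transform on `Re s > 1` is `(1/s)·∫₁^∞ ψ x^{−s−1} = ((s−1)⁻¹ − ζ₁′/ζ₁(s))/s²` (Fubini: `W` is a primitive);
§3 the transform of `x^b − η(W(x) − x)` continues to `1/(s−b) + η(ζ₁′/ζ₁(s) + s + 1)/s²` (the pole at `1` cancels), holomorphic on
`{Re s > b} ∖ {zeros}`, so Landau's lemma (Literature `Landau.integrableOn_of_differentiableOn_union_convex`) and the ODE
trick `ζ₁′ = aζ₁` of the tree give the contradiction with a zero of real part `> b`.  Standard axioms only.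
-/

set_option linter.dupNamespace false
set_option autoImplicit false

noncomputable section

open Complex Filter Topology Set MeasureTheory Asymptotics intervalIntegral
open scoped Chebyshev

namespace Summit.RiemannHypothesis.RiemannHypothesis.Theorems.WeilFormatC

namespace LogRiesz

open Literature.NumberTheory.LFunctions Landau Nicolas PsiOmega

/-! ## §1 The logarithmic Riesz mean `W(x) = ∫₁ˣ ψ(t)dt/t` -/

/-- `|t⁻¹ψ(t)| ≤ ψ(t)` everywhere (for `t < 1`, `ψ(t) = 0`). -/
theorem abs_inv_mul_psi_le (t : ℝ) : |t⁻¹ * ψ t| ≤ ψ t := by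
  rcases lt_or_ge t 2 with ht | ht
  · rw [Chebyshev.psi_eq_zero_of_lt_two ht]; simp
  · rw [abs_of_nonneg (mul_nonneg (inv_nonneg.2 (by linarith)) (Chebyshev.psi_nonneg t))]
    have h1 : t⁻¹ ≤ 1 := inv_le_one_of_one_le₀ (by linarith)
    exact (mul_le_mul_of_nonneg_right h1 (Chebyshev.psi_nonneg t)).trans (by rw [one_mul])

/-- `t ↦ t⁻¹ψ(t)` is measurable. -/
theorem measurable_inv_mul_psi : Measurable fun t : ℝ ↦ t⁻¹ * ψ t := measurable_inv.mul measurable_psi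

/-- `t⁻¹ψ(t)` is integrable on every bounded interval (dominated by the monotone `ψ`). -/
theorem intervalIntegrable_inv_mul_psi (a b : ℝ) : IntervalIntegrable (fun t : ℝ ↦ t⁻¹ * ψ t) volume a b :=
  (Chebyshev.psi_mono.intervalIntegrable (a := a) (b := b)).mono_fun'
    measurable_inv_mul_psi.aestronglyMeasurable (ae_of_all _ fun t ↦ by
      show ‖t⁻¹ * ψ t‖ ≤ ψ t
      rw [Real.norm_eq_abs]; exact abs_inv_mul_psi_le t)

/-- `W` is continuous. -/
theorem continuous_logRiesz : Continuous fun x : ℝ ↦ ∫ t in (1:ℝ)..x, t⁻¹ * ψ t :=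
  continuous_primitive intervalIntegrable_inv_mul_psi 1

/-- `W` is measurable. -/
theorem measurable_logRiesz : Measurable fun x : ℝ ↦ ∫ t in (1:ℝ)..x, t⁻¹ * ψ t :=
  continuous_logRiesz.measurable

/-- `0 ≤ t⁻¹ψ(t) ≤ 7` for `t ≥ 1`. -/
theorem inv_mul_psi_bounds {t : ℝ} (ht : 1 ≤ t) : 0 ≤ t⁻¹ * ψ t ∧ t⁻¹ * ψ t ≤ 7 := by
  have ht0 : 0 < t := by linarith
  refine ⟨mul_nonneg (inv_nonneg.2 ht0.le) (Chebyshev.psi_nonneg t), ?_⟩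
  have h := abs_psi_sub_self_le ht0.le
  have hψ : ψ t ≤ 7 * t := by have := (abs_le.1 h).2; linarith
  calc t⁻¹ * ψ t ≤ t⁻¹ * (7 * t) := mul_le_mul_of_nonneg_left hψ (inv_nonneg.2 ht0.le)
    _ = 7 := by field_simp

/-- `0 ≤ W(x) ≤ 7x` for `x ≥ 1`. -/
theorem logRiesz_bounds {x : ℝ} (hx : 1 ≤ x) :
    0 ≤ (∫ t in (1:ℝ)..x, t⁻¹ * ψ t) ∧ (∫ t in (1:ℝ)..x, t⁻¹ * ψ t) ≤ 7 * x := by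
  constructor
  · exact intervalIntegral.integral_nonneg hx fun t ht ↦ (inv_mul_psi_bounds ht.1).1
  · calc (∫ t in (1:ℝ)..x, t⁻¹ * ψ t) ≤ ∫ _ in (1:ℝ)..x, (7 : ℝ) :=
          intervalIntegral.integral_mono_on hx (intervalIntegrable_inv_mul_psi 1 x) (by simp)
            fun t ht ↦ (inv_mul_psi_bounds ht.1).2
      _ = 7 * (x - 1) := by rw [intervalIntegral.integral_const]; simp; ring
      _ ≤ 7 * x := by linarith

/-! ## §2 The Mellin transform of `W`: `∫₁^∞ W(x)x^{−s−1}dx = (1/s)∫₁^∞ ψ(x)x^{−s−1}dx` -/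

/-- **Mellin transform of the primitive**: for `Re s > 1`,
`mellinIoi W s = (mellinIoi ψ s)/s` (Fubini on `1 < t ≤ x`, `∫_t^∞ x^{−s−1}dx = t^{−s}/s`). -/
theorem mellinIoi_logRiesz {s : ℂ} (hs : 1 < s.re) :
    mellinIoi (fun x : ℝ ↦ ∫ t in (1:ℝ)..x, t⁻¹ * ψ t) s = mellinIoi ψ s / s := by
  have hs0 : s ≠ 0 := by rintro rfl; simp at hs; linarith
  set σ := s.re with hσ
  set a : ℝ := (σ + 1) / 2 with ha
  set μ : Measure ℝ := volume.restrict (Ioi (1:ℝ)) with hμ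
  set h : ℝ → ℂ := fun t ↦ ((t⁻¹ * ψ t : ℝ) : ℂ) with hh
  set k : ℝ → ℂ := fun x ↦ (x : ℂ) ^ (-(s + 1)) with hk
  set F : ℝ → ℝ → ℂ := fun x t ↦ (Iic x).indicator h t * k x with hF
  have hmeas_h : Measurable h := measurable_ofReal.comp measurable_inv_mul_psi
  have hmeas_k : Measurable k := measurable_ofReal.pow_const _
  have hnorm_k : ∀ x : ℝ, 0 < x → ‖k x‖ = x ^ (-(σ + 1)) := by
    intro x hx
    rw [hk, Complex.norm_cpow_eq_rpow_re_of_pos hx]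
    simp [hσ]
  have hFm : AEStronglyMeasurable (Function.uncurry F) (μ.prod μ) := by
    have : Function.uncurry F = ({p : ℝ × ℝ | p.2 ≤ p.1}).indicator (fun p ↦ h p.2 * k p.1) := by
      funext p
      rcases p with ⟨x, t⟩
      simp only [Function.uncurry_apply_pair, hF, Set.indicator_apply, Set.mem_Iic, Set.mem_setOf_eq]
      split_ifs <;> simp
    rw [this]
    exact (((hmeas_h.comp measurable_snd).mul (hmeas_k.comp measurable_fst)).indicator
      (measurableSet_le measurable_snd measurable_fst)).aestronglyMeasurable
  have hIa : Integrable (fun x : ℝ ↦ x ^ (-a)) μ := integrableOn_Ioi_rpow_of_lt (by linarith) zero_lt_one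
  have hFi : Integrable (Function.uncurry F) (μ.prod μ) := by
    refine Integrable.mono' ((hIa.norm.const_mul 7).mul_prod hIa.norm) hFm ?_
    rw [hμ, Measure.prod_restrict, ae_restrict_iff' (measurableSet_Ioi.prod measurableSet_Ioi)]
    refine ae_of_all _ fun p hp ↦ ?_
    rcases p with ⟨x, t⟩
    simp only [Set.mem_prod, Set.mem_Ioi] at hp
    have hx0 : 0 < x := by linarith [hp.1]
    have ht0 : 0 < t := by linarith [hp.2]
    simp only [Function.uncurry_apply_pair, hF, Real.norm_eq_abs, abs_of_pos (Real.rpow_pos_of_pos hx0 _),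
      abs_of_pos (Real.rpow_pos_of_pos ht0 _)]
    by_cases htx : t ≤ x
    · rw [Set.indicator_of_mem (show t ∈ Iic x from htx), norm_mul, hnorm_k x hx0, hh, Complex.norm_real,
        Real.norm_eq_abs, abs_of_nonneg (inv_mul_psi_bounds hp.2.le).1]
      have h7 := (inv_mul_psi_bounds hp.2.le).2
      have hsplit : x ^ (-(σ + 1)) = x ^ (-a) * x ^ (-a) := by
        rw [← Real.rpow_add hx0]; congr 1; rw [ha]; ring
      have hxt : x ^ (-a) ≤ t ^ (-a) :=
        Real.rpow_le_rpow_of_nonpos ht0 htx (by linarith)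
      rw [hsplit]
      have h0 : 0 ≤ x ^ (-a) := (Real.rpow_pos_of_pos hx0 _).le
      calc t⁻¹ * ψ t * (x ^ (-a) * x ^ (-a)) ≤ 7 * (x ^ (-a) * t ^ (-a)) :=
            mul_le_mul h7 (mul_le_mul_of_nonneg_left hxt h0) (by positivity) (by norm_num)
        _ = 7 * x ^ (-a) * t ^ (-a) := by ring
    · rw [Set.indicator_of_notMem (show t ∉ Iic x from htx), zero_mul, norm_zero]
      positivity
  have hswap := integral_integral_swap hFi
  have hL : ∀ x : ℝ, 1 < x → ∫ t, F x t ∂μ = ((∫ t in (1:ℝ)..x, t⁻¹ * ψ t : ℝ) : ℂ) * k x := by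
    intro x hx
    simp only [hF]
    rw [MeasureTheory.integral_mul_const, hμ, MeasureTheory.integral_indicator measurableSet_Iic, Measure.restrict_restrict measurableSet_Iic,
      show Iic x ∩ Ioi 1 = Ioc 1 x by ext t; simp [and_comm], intervalIntegral.integral_of_le hx.le]
    simp only [hh]
    rw [integral_complex_ofReal]
  have hR : ∀ t : ℝ, 1 < t → ∫ x, F x t ∂μ = h t * ((t : ℂ) ^ (-s) / s) := by
    intro t ht
    have ht0 : 0 < t := by linarith
    have hind : ∀ x : ℝ, F x t = h t * (Ici t).indicator k x := by
      intro x
      simp only [hF, Set.indicator_apply, Set.mem_Iic, Set.mem_Ici]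
      split_ifs <;> simp
    simp_rw [hind]
    rw [MeasureTheory.integral_const_mul, hμ, MeasureTheory.integral_indicator measurableSet_Ici, Measure.restrict_restrict measurableSet_Ici,
      show Ici t ∩ Ioi 1 = Ici t by ext x; simp only [Set.mem_inter_iff, Set.mem_Ici, Set.mem_Ioi]; constructor
        <;> [exact fun h ↦ h.1; exact fun h ↦ ⟨h, lt_of_lt_of_le ht h⟩],
      integral_Ici_eq_integral_Ioi, hk, integral_Ioi_cpow_of_lt (by simp; linarith) ht0]
    congr 1
    rw [show -(s + 1) + 1 = -s by ring, neg_div, div_neg, neg_neg]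
  have hLHS : mellinIoi (fun x : ℝ ↦ ∫ t in (1:ℝ)..x, t⁻¹ * ψ t) s = ∫ x, ∫ t, F x t ∂μ ∂μ := by
    rw [mellinIoi, ← hμ]
    refine integral_congr_ae ?_
    rw [hμ, Filter.EventuallyEq, ae_restrict_iff' measurableSet_Ioi]
    exact ae_of_all _ fun x hx ↦ (hL x hx).symm
  have hRHS : ∫ t, ∫ x, F x t ∂μ ∂μ = mellinIoi ψ s / s := by
    rw [mellinIoi, ← hμ, div_eq_mul_inv, ← MeasureTheory.integral_mul_const]
    refine integral_congr_ae ?_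
    rw [hμ, Filter.EventuallyEq, ae_restrict_iff' measurableSet_Ioi]
    refine ae_of_all _ fun t ht ↦ ?_
    have ht0 : 0 < t := lt_trans zero_lt_one ht
    have htc : (t : ℂ) ≠ 0 := by exact_mod_cast ht0.ne'
    rw [hR t ht, hh]
    have : (t : ℂ) ^ (-(s + 1)) = (t : ℂ) ^ (-s) * (t : ℂ)⁻¹ := by
      rw [show -(s + 1) = -s + (-1) by ring, Complex.cpow_add _ _ htc, Complex.cpow_neg_one]
    rw [this]
    push_cast
    field_simp
  rw [hLHS, hswap, hRHS]

/-! ## §3 Landau's method for `x^b − η(W(x) − x)` -/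

/-- Measurability of the comparison function `x^b − η(W(x) − x)`. -/
theorem measurable_logRieszCmp (b η : ℝ) :
    Measurable (fun x : ℝ ↦ x ^ b - η * ((∫ t in (1:ℝ)..x, t⁻¹ * ψ t) - x)) :=
  (measurable_id.pow_const b).sub ((measurable_logRiesz.sub measurable_id).const_mul η)

/-- `|W(x) − x| ≤ 8x` on `(1, ∞)`, so `(W − x)x^{−(σ+1)}` is integrable there for `σ > 1`. -/
theorem integrableOn_logRiesz_sub_self_rpow {σ : ℝ} (hσ : 1 < σ) :
    IntegrableOn (fun x : ℝ ↦ ((∫ t in (1:ℝ)..x, t⁻¹ * ψ t) - x) * x ^ (-(σ + 1))) (Ioi 1) := by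
  refine Integrable.mono'
    ((integrableOn_Ioi_rpow_of_lt (show -σ < -1 by linarith) zero_lt_one).const_mul 8)
    (((measurable_logRiesz.sub measurable_id).mul (measurable_id.pow_const _)).aestronglyMeasurable) ?_
  rw [ae_restrict_iff' measurableSet_Ioi]
  refine ae_of_all _ fun x hx ↦ ?_
  have hx1 : 1 < x := hx
  have hx0 : 0 < x := by linarith
  obtain ⟨h0, h7⟩ := logRiesz_bounds hx1.le
  rw [Real.norm_eq_abs, abs_mul, abs_of_nonneg (Real.rpow_nonneg hx0.le _)]
  have habs : |(∫ t in (1:ℝ)..x, t⁻¹ * ψ t) - x| ≤ 8 * x := abs_le.2 ⟨by linarith, by linarith⟩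
  calc |(∫ t in (1:ℝ)..x, t⁻¹ * ψ t) - x| * x ^ (-(σ + 1)) ≤ 8 * x * x ^ (-(σ + 1)) :=
        mul_le_mul_of_nonneg_right habs (Real.rpow_nonneg hx0.le _)
    _ = 8 * x ^ (-σ) := by
        rw [show (-(σ + 1)) = -σ - 1 by ring, Real.rpow_sub hx0, Real.rpow_one]
        field_simp

/-- Integrability of the comparison function against `x^{-(2+1)}`. -/
theorem integrableOn_logRieszCmp_two {b : ℝ} (η : ℝ) (hb1 : b ≤ 1) :
    IntegrableOn (fun x : ℝ ↦ (x ^ b - η * ((∫ t in (1:ℝ)..x, t⁻¹ * ψ t) - x)) * x ^ (-((2:ℝ) + 1))) (Ioi 1) := by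
  have h1 := integrableOn_rpow_rpow (b := b) (σ := 2) (by linarith)
  have h2 : IntegrableOn (fun x : ℝ ↦ (η * ((∫ t in (1:ℝ)..x, t⁻¹ * ψ t) - x)) * x ^ (-((2:ℝ) + 1))) (Ioi 1) := by
    have := (integrableOn_logRiesz_sub_self_rpow (σ := 2) (by norm_num)).const_mul η
    refine this.congr (Eventually.of_forall fun x ↦ ?_)
    ring
  exact integrableOn_sub_rpow (f := fun x : ℝ ↦ x ^ b)
    (g := fun x : ℝ ↦ η * ((∫ t in (1:ℝ)..x, t⁻¹ * ψ t) - x)) h1 h2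

/-- **The transform of the comparison function on `Re s > 1`**:
`Φ(s) = 1/(s − b) + η(ζ₁′/ζ₁(s) + s + 1)/s²` (the pole at `s = 1` cancels). -/
theorem mellinIoi_logRieszCmp {b η : ℝ} (hb1 : b ≤ 1) {s : ℂ} (hs : 1 < s.re) :
    mellinIoi (fun x : ℝ ↦ x ^ b - η * ((∫ t in (1:ℝ)..x, t⁻¹ * ψ t) - x)) s =
      1 / (s - b) + η * ((logDeriv riemannZeta₁ s + s + 1) / s ^ 2) := by
  have hbs : b < s.re := lt_of_le_of_lt hb1 hs
  have hf := integrable_ofReal_mul_cpow (g := fun x : ℝ ↦ x ^ b) (measurable_id.pow_const b)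
    (σ₁ := (b + s.re) / 2) (s := s) (integrableOn_rpow_rpow (by linarith)) (by linarith)
  have hW0 := integrable_ofReal_mul_cpow (g := fun x : ℝ ↦ (∫ t in (1:ℝ)..x, t⁻¹ * ψ t) - x)
    (measurable_logRiesz.sub measurable_id) (σ₁ := (1 + s.re) / 2) (s := s)
    (integrableOn_logRiesz_sub_self_rpow (by linarith)) (by linarith)
  have hg : Integrable (fun x : ℝ ↦ ((η * ((∫ t in (1:ℝ)..x, t⁻¹ * ψ t) - x) : ℝ) : ℂ) * (x : ℂ) ^ (-(s + 1)))
      (volume.restrict (Ioi 1)) := by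
    refine (hW0.const_mul (η : ℂ)).congr (Eventually.of_forall fun x ↦ ?_)
    push_cast; ring
  have hW1 := integrable_ofReal_mul_cpow (g := fun x : ℝ ↦ ∫ t in (1:ℝ)..x, t⁻¹ * ψ t) measurable_logRiesz
    (σ₁ := (1 + s.re) / 2) (s := s) ?_ (by linarith)
  · have hx := integrable_ofReal_mul_cpow (g := fun x : ℝ ↦ x) measurable_id (σ₁ := (1 + s.re) / 2)
      (s := s) ?_ (by linarith)
    · rw [mellinIoi_sub' hf hg, mellinIoi_const_mul, mellinIoi_rpow hbs, mellinIoi_sub' hW1 hx,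
        mellinIoi_logRiesz hs, mellinIoi_psi hs, mellinIoi_self hs]
      have hs1 : s - 1 ≠ 0 := by
        intro h; have := congrArg Complex.re h; simp at this; linarith
      have hs0 : s ≠ 0 := by rintro rfl; simp at hs; linarith
      field_simp
      ring
    · have := integrableOn_rpow_rpow (b := 1) (σ := (1 + s.re) / 2) (by linarith)
      exact this.congr_fun (fun x _ ↦ by simp only [Real.rpow_one]) measurableSet_Ioi
  · have ha := integrableOn_logRiesz_sub_self_rpow (σ := (1 + s.re) / 2) (by linarith)
    have hb := integrableOn_rpow_rpow (b := 1) (σ := (1 + s.re) / 2) (by linarith)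
    refine (integrableOn_add_rpow ha hb).congr_fun (fun x _ ↦ ?_) measurableSet_Ioi
    simp only [Real.rpow_one]; ring

/-- The continuation `Φ` is holomorphic at every `s` with `Re s > b > 0` where `ζ₁(s) ≠ 0`. -/
theorem differentiableAt_logRieszCont {b η : ℝ} (hb0 : 0 < b) {s : ℂ} (hs : b < s.re)
    (hζ : riemannZeta₁ s ≠ 0) :
    DifferentiableAt ℂ (fun z : ℂ ↦ 1 / (z - b) + η * ((logDeriv riemannZeta₁ z + z + 1) / z ^ 2)) s := by
  have hs0 : s ≠ 0 := by rintro rfl; simp at hs; linarith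
  have hsb : s - b ≠ 0 := by
    intro h; have := congrArg Complex.re h; simp at this; linarith
  have d1 : DifferentiableAt ℂ (fun z : ℂ ↦ 1 / (z - b)) s :=
    (differentiableAt_const _).div (differentiableAt_id.sub (differentiableAt_const _)) hsb
  have d2 : DifferentiableAt ℂ (logDeriv riemannZeta₁) s :=
    (PsiOneExplicit.analyticAt_logDeriv_riemannZeta₁ hζ).differentiableAt
  have d3 : DifferentiableAt ℂ (fun z : ℂ ↦ (η : ℂ) * ((logDeriv riemannZeta₁ z + z + 1) / z ^ 2)) s :=
    (((d2.add differentiableAt_id).add_const 1).div (differentiableAt_id.pow 2) (pow_ne_zero 2 hs0)).const_mul _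
  exact d1.add d3

/-- **Landau's theorem applied**: if `0 < b ≤ 1` and `x^b − η(W(x) − x) ≥ 0` beyond `X₁`, the transform converges absolutely
at every real `σ > b`. -/
theorem integrableOn_logRieszCmp_of_nonneg {b η X₁ : ℝ} (hb0 : 0 < b) (hb1 : b ≤ 1) (hX₁ : 1 ≤ X₁)
    (hpos : ∀ x, X₁ < x → 0 ≤ x ^ b - η * ((∫ t in (1:ℝ)..x, t⁻¹ * ψ t) - x)) {σ : ℝ} (hσ : b < σ) :
    IntegrableOn (fun x ↦ (x ^ b - η * ((∫ t in (1:ℝ)..x, t⁻¹ * ψ t) - x)) * x ^ (-(σ + 1))) (Ioi 1) := by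
  set Φ : ℂ → ℂ := fun z ↦ 1 / (z - b) + η * ((logDeriv riemannZeta₁ z + z + 1) / z ^ 2) with hΦ
  obtain ⟨δ, hδ, -, hgap⟩ := ZetaZeroSum.exists_gap_im
  set W₀ : Set ℂ := {s : ℂ | b < s.re ∧ -(2 * δ) < s.im ∧ s.im < 2 * δ} with hW₀
  have hW₀o : IsOpen W₀ :=
    (isOpen_lt continuous_const Complex.continuous_re).inter
      ((isOpen_lt continuous_const Complex.continuous_im).inter
        (isOpen_lt Complex.continuous_im continuous_const))
  have hW₀c : Convex ℝ W₀ := by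
    have : W₀ = {s : ℂ | b < s.re} ∩ ({s : ℂ | -(2 * δ) < s.im} ∩ {s : ℂ | s.im < 2 * δ}) := by
      ext s; simp [hW₀]
    rw [this]
    exact (convex_halfSpace_re_gt _).inter ((convex_halfSpace_im_gt _).inter (convex_halfSpace_im_lt _))
  have hW₀r : ∀ σ' : ℝ, b < σ' → σ' ≤ 2 + 1 → (σ' : ℂ) ∈ W₀ := by
    intro σ' h1 _
    simp only [hW₀, Set.mem_setOf_eq, Complex.ofReal_re, Complex.ofReal_im]
    exact ⟨h1, by linarith, by linarith⟩
  have hΦd : DifferentiableOn ℂ Φ ({s : ℂ | 2 < s.re} ∪ W₀) := by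
    intro s hs
    apply DifferentiableAt.differentiableWithinAt
    rcases hs with hs | hs
    · simp only [Set.mem_setOf_eq] at hs
      have hs1 : s ≠ 1 := by rintro rfl; simp at hs
      refine differentiableAt_logRieszCont hb0 (by linarith) ?_
      rw [Ne, riemannZeta₁_eq_zero_iff hs1]
      exact riemannZeta_ne_zero_of_one_lt_re (by linarith)
    · refine differentiableAt_logRieszCont hb0 hs.1 ?_
      exact PsiOneExplicit.riemannZeta₁_ne_zero_of_abs_im_lt hgap (abs_lt.2 ⟨hs.2.1, hs.2.2⟩)
        (by linarith [hs.1])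
  have hagree : EqOn Φ (mellinIoi fun x : ℝ ↦ x ^ b - η * ((∫ t in (1:ℝ)..x, t⁻¹ * ψ t) - x))
      {s : ℂ | 2 < s.re} := by
    intro s hs
    simp only [Set.mem_setOf_eq] at hs
    exact (mellinIoi_logRieszCmp hb1 (by linarith)).symm
  exact Landau.integrableOn_of_differentiableOn_union_convex (measurable_logRieszCmp b η)
    (integrableOn_logRieszCmp_two η hb1) hX₁ hpos (by linarith : b < 2) hW₀o hW₀c hW₀r hΦd hagree hσ

/-- **The contradiction with a zero**: `0 < b ≤ 1`, `x^b − η(W(x) − x) ≥ 0` beyond `X₁`, and `ζ(ρ₀) = 0` with `Re ρ₀ > b`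
are incompatible (Landau + the ODE `ζ₁′ = aζ₁` on `Re s > b`, `a = η s²(F − 1/(s−b)) − s − 1`). -/
theorem false_of_nonneg_of_zero {b η X₁ : ℝ} (hb0 : 0 < b) (hb1 : b ≤ 1) (hη : η = 1 ∨ η = -1)
    (hX₁ : 1 ≤ X₁) (hpos : ∀ x, X₁ < x → 0 ≤ x ^ b - η * ((∫ t in (1:ℝ)..x, t⁻¹ * ψ t) - x)) {ρ₀ : ℂ}
    (hζ : riemannZeta ρ₀ = 0) (hρ : b < ρ₀.re) : False := by
  have hηsq : (η : ℂ) * η = 1 := by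
    rcases hη with rfl | rfl <;> push_cast <;> norm_num
  set g : ℝ → ℝ := fun x ↦ x ^ b - η * ((∫ t in (1:ℝ)..x, t⁻¹ * ψ t) - x) with hg
  have hI : ∀ σ' : ℝ, b < σ' → IntegrableOn (fun x ↦ g x * x ^ (-(σ' + 1))) (Ioi 1) :=
    fun σ' hσ' ↦ integrableOn_logRieszCmp_of_nonneg hb0 hb1 hX₁ hpos hσ'
  set F : ℂ → ℂ := mellinIoi g with hF
  set U : Set ℂ := {s : ℂ | b < s.re} with hU
  have hUo : IsOpen U := isOpen_lt continuous_const Complex.continuous_re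
  have hFd : DifferentiableOn ℂ F U := differentiableOn_mellinIoi_of_forall (measurable_logRieszCmp b η) hI
  set a : ℂ → ℂ := fun s ↦ (η : ℂ) * (s ^ 2 * (F s - 1 / (s - b))) - s - 1 with ha
  have had : DifferentiableOn ℂ a U := by
    intro s hs
    have hsb : s - b ≠ 0 := by
      intro h; have := congrArg Complex.re h; simp [hU] at this hs; linarith
    have d0 : DifferentiableAt ℂ (fun z : ℂ ↦ 1 / (z - b)) s :=
      (differentiableAt_const _).div (differentiableAt_id.sub (differentiableAt_const _)) hsb
    exact ((((differentiableWithinAt_id.pow 2).mul ((hFd s hs).sub d0.differentiableWithinAt)).const_mul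
      _).sub differentiableWithinAt_id).sub_const _
  have hODE₂ : ∀ s : ℂ, 2 < s.re → deriv riemannZeta₁ s = a s * riemannZeta₁ s := by
    intro s hs
    have hs1 : s ≠ 1 := by rintro rfl; simp at hs
    have hs0 : s ≠ 0 := by rintro rfl; simp at hs; linarith
    have hζ₁ : riemannZeta₁ s ≠ 0 := by
      rw [Ne, riemannZeta₁_eq_zero_iff hs1]
      exact riemannZeta_ne_zero_of_one_lt_re (by linarith)
    have hFs : F s = 1 / (s - b) + η * ((logDeriv riemannZeta₁ s + s + 1) / s ^ 2) :=
      mellinIoi_logRieszCmp hb1 (by linarith)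
    have haL : a s = logDeriv riemannZeta₁ s := by
      have h1 : F s - 1 / (s - b) = η * ((logDeriv riemannZeta₁ s + s + 1) / s ^ 2) := by
        rw [hFs]; ring
      have h2 : s ^ 2 * ((η : ℂ) * ((logDeriv riemannZeta₁ s + s + 1) / s ^ 2)) =
          η * (logDeriv riemannZeta₁ s + s + 1) := by
        field_simp
      simp only [ha, h1, h2]
      linear_combination (logDeriv riemannZeta₁ s + s + 1) * hηsq
    rw [haL, logDeriv_apply, div_mul_cancel₀ _ hζ₁]
  have hODE : EqOn (deriv riemannZeta₁) (fun s ↦ a s * riemannZeta₁ s) U := by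
    set D : ℂ → ℂ := fun s ↦ deriv riemannZeta₁ s - a s * riemannZeta₁ s with hD
    have hDd : DifferentiableOn ℂ D U := by
      intro s hs
      exact ((differentiable_riemannZeta₁.analyticAt s).deriv.differentiableAt.differentiableWithinAt).sub
        ((had s hs).mul (differentiable_riemannZeta₁ s).differentiableWithinAt)
    have hDa : AnalyticOnNhd ℂ D U := hDd.analyticOnNhd hUo
    have hUpre : IsPreconnected U := (convex_halfSpace_re_gt b).isPreconnected
    have h3U : (3 : ℂ) ∈ U := by simp only [hU, Set.mem_setOf_eq]; norm_num; linarith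
    have hev : D =ᶠ[𝓝 (3 : ℂ)] 0 := by
      have h3 : (3 : ℂ) ∈ {s : ℂ | 2 < s.re} := by simp only [Set.mem_setOf_eq]; norm_num
      filter_upwards [(isOpen_lt continuous_const Complex.continuous_re).mem_nhds h3] with s hs
      simp only [hD, Pi.zero_apply, hODE₂ s hs, sub_self]
    have hz := hDa.eqOn_zero_of_preconnected_of_eventuallyEq_zero hUpre h3U hev
    intro s hs
    have := hz hs
    simp only [hD, Pi.zero_apply, sub_eq_zero] at this
    exact this
  have hρ1 : ρ₀ ≠ 1 := by
    rintro rfl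
    exact riemannZeta_one_ne_zero hζ
  have hζ₁ : riemannZeta₁ ρ₀ = 0 := (riemannZeta₁_eq_zero_iff hρ1).2 hζ
  have hzero := eq_zero_of_deriv_eq_mul differentiable_riemannZeta₁ hUo had hODE
    (show ρ₀ ∈ U from hρ) hζ₁
  have h1 := congrFun hzero 1
  rw [riemannZeta₁_one, Pi.zero_apply] at h1
  exact one_ne_zero h1

/-- **`Ω₊` for the logarithmic Riesz mean**: for a zero `ρ₀` of `ζ` and `0 < b < Re ρ₀`,
`W(x) − x ≥ x^b` for arbitrarily large `x`. -/
theorem frequently_rpow_le_logRiesz_sub {ρ₀ : ℂ} (hζ : riemannZeta ρ₀ = 0) {b : ℝ} (hb0 : 0 < b)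
    (hb : b < ρ₀.re) : ∃ᶠ x in atTop, x ^ b ≤ (∫ t in (1:ℝ)..x, t⁻¹ * ψ t) - x := by
  have hρre : ρ₀.re < 1 := by
    by_contra h
    exact riemannZeta_ne_zero_of_one_le_re (not_lt.1 h) hζ
  have hb1 : b ≤ 1 := by linarith
  by_contra hnot
  rw [Filter.not_frequently] at hnot
  obtain ⟨X, hX⟩ := Filter.eventually_atTop.1 hnot
  refine false_of_nonneg_of_zero (η := 1) (X₁ := max X 1) hb0 hb1 (Or.inl rfl) (le_max_right _ _)
    (fun x hx ↦ ?_) hζ hb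
  have := hX x ((le_max_left _ _).trans hx.le)
  simp only [one_mul, not_le] at this ⊢
  linarith

end LogRiesz

end Summit.RiemannHypothesis.RiemannHypothesis.Theorems.WeilFormatC
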